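import Summits.QuantumFields.YangMills.Theorems.ConvexGribovBodyContinuumLegGivenGapCsclTorusForms
import HarnessLib

/-!
# `ContinuumLegGivenGap` (stmt-QuantumFields-15828), line `Sketch`, reshape 17-CS, helper 2 of `stub_csclOfLock`:
# Cauchy–Schwarz of the two forms; the reflected time correlation of a positive-time observable is non-negative and
# log-convex on the odd torus

Sequel of `…CsclTorusForms`. On the torus of side `2S+1` at `β ≥ 0` (`Ũ = torusLift _ U`, `Θ = gaugeTimeReflect`,
`τᶜ = configShift (−c e₀)`), for bounded measurable complex cylinder observables supported at lattice times in
`[lo, hi]`: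
* `cscl_bond_cs`, `cscl_site_cs` — Cauchy–Schwarz and reality/positivity of the diagonal for the bond form
  `∫ conj X(ΘŨ) Y(Ũ)` and the site form `∫ conj X(ΘŨ) Y(τŨ)` (tree `torus_rp_bond` / `torus_rp_site`);
* `cscl_isCylinder_shift` (+ time range of the shifted support), `cscl_timeSupp_finset` (a time range gives a
  positive-time edge set with controlled `maxTime`);
* `cscl_seq_nonneg`, `cscl_seq_logConvex` — for `A` supported at times in `[0, w]`, the sequence
  `m ↦ P_m(A,A) = ∫ conj A(ΘŨ) A(τᵐŨ)` is real non-negative and log-convex as long as `m + 2w + 6 ≤ 2S`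
  (`P_{2a} = Q₀(Aτᵃ, Aτᵃ)`, `P_{2a+1} = Q₁(Aτᵃ, Aτᵃ) = Q₀(Aτᵃ, Aτᵃ⁺¹)`, `P_{2a} = Q₁(Aτᵃ⁻¹, Aτᵃ)` and Cauchy–Schwarz).
Registered anchor: `cscl_anchor_chord`. Refs: Osterwalder–Seiler 1978 §2; Glimm–Jaffe 1987 §6.1. No definitions.
-/

noncomputable section

open scoped ComplexConjugate
open MeasureTheory Filter
open Literature.MathematicalPhysics.QuantumFieldTheory Literature.MathematicalPhysics.QuantumLattice
open Summit.QuantumFields.YangMills.Theorems.ClusteringToYangMills.Reconstructible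
open Summit.QuantumFields.YangMills.Theorems.CriticalContinuumLimit.AdmissibleGap (maxTime torus_rp_bond torus_rp_site)

namespace Summit.QuantumFields.YangMills.Theorems.ContinuumLegGivenGap

section Torus

variable {G : Type} [Group G] [TopologicalSpace G] [IsTopologicalGroup G] [CompactSpace G]
  [MeasurableSpace G] [BorelSpace G] {N : ℕ} (ρ : G →* Matrix (Fin N) (Fin N) ℂ)

/-- **Cauchy–Schwarz for the bond form** on positive-time cylinder observables (`maxTime + 1 ≤ S`, `S ≥ 1`,
`β ≥ 0`): `‖Q₀(X,Y)‖² ≤ Re Q₀(X,X) · Re Q₀(Y,Y)`, and `Q₀(X,X)` is real `≥ 0`. [folklore] -/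
theorem cscl_bond_cs (hρ : Continuous ρ) {β : ℝ} (hβ : 0 ≤ β) {S : ℕ} (hS1 : 1 ≤ S) {X Y : LGConfig 4 G → ℂ}
    (hXm : Measurable X) (hYm : Measurable Y) (hXb : ∃ C : ℝ, ∀ U, ‖X U‖ ≤ C) (hYb : ∃ C : ℝ, ∀ U, ‖Y U‖ ≤ C)
    {ΛX ΛY : Finset (Literature.MathematicalPhysics.QuantumLattice.ZdEdge 4)} (hX : IsCylinder X ΛX) (hY : IsCylinder Y ΛY)
    (hΛX : (↑ΛX : Set (Literature.MathematicalPhysics.QuantumLattice.ZdEdge 4)) ⊆ posTimeEdges) (hΛY : (↑ΛY : Set (Literature.MathematicalPhysics.QuantumLattice.ZdEdge 4)) ⊆ posTimeEdges)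
    (hSX : maxTime ΛX + 1 ≤ S) (hSY : maxTime ΛY + 1 ≤ S) :
    ‖∫ U, conj (X (gaugeTimeReflect (torusLift (2 * S + 1) U))) * Y (torusLift (2 * S + 1) U)
        ∂(wilsonMeasure (d := 4) (L := 2 * S + 1) ρ β)‖ ^ 2 ≤
      (∫ U, conj (X (gaugeTimeReflect (torusLift (2 * S + 1) U))) * X (torusLift (2 * S + 1) U)
        ∂(wilsonMeasure (d := 4) (L := 2 * S + 1) ρ β)).re *
      (∫ U, conj (Y (gaugeTimeReflect (torusLift (2 * S + 1) U))) * Y (torusLift (2 * S + 1) U)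
        ∂(wilsonMeasure (d := 4) (L := 2 * S + 1) ρ β)).re ∧
    0 ≤ (∫ U, conj (X (gaugeTimeReflect (torusLift (2 * S + 1) U))) * X (torusLift (2 * S + 1) U)
        ∂(wilsonMeasure (d := 4) (L := 2 * S + 1) ρ β)).re ∧
    (∫ U, conj (X (gaugeTimeReflect (torusLift (2 * S + 1) U))) * X (torusLift (2 * S + 1) U)
        ∂(wilsonMeasure (d := 4) (L := 2 * S + 1) ρ β)).im = 0 := by
  refine ⟨?_, torus_rp_bond ρ hρ hβ hS1 hXm hXb hX hΛX hSX, ?_⟩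
  · refine cscl_cs_of_psd _ _ _ fun c => ?_
    -- positivity of `Q₀(X + cY, X + cY)`
    obtain ⟨CX, hCX⟩ := hXb
    obtain ⟨CY, hCY⟩ := hYb
    have hFm : Measurable fun V => X V + c * Y V := hXm.add (hYm.const_mul c)
    have hFb : ∃ C : ℝ, ∀ U, ‖X U + c * Y U‖ ≤ C := ⟨CX + ‖c‖ * CY, fun U =>
      (norm_add_le _ _).trans (add_le_add (hCX U) (by rw [norm_mul]; exact mul_le_mul_of_nonneg_left (hCY U) (norm_nonneg _)))⟩
    have hpos := torus_rp_bond (S := S) ρ hρ hβ hS1 hFm hFb (cscl_isCylinder_add_smul hX hY c)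
      (by rw [Finset.coe_union]; exact Set.union_subset hΛX hΛY)
      (by rw [cscl_maxTime_union]; omega)
    have hexp := cscl_form_expand ρ hρ β hXm hYm ⟨CX, hCX⟩ ⟨CY, hCY⟩ c (L := 2 * S + 1) 0
    simp only [Pi.single_zero, neg_zero, rpShift_configShift_zero] at hexp
    rw [hexp, cscl_bond_herm ρ hρ β (2 * S + 1) X Y, ← map_mul, Complex.conj_mul' c, ← Complex.ofReal_pow] at hpos
    simp only [Complex.add_re, Complex.conj_re, Complex.re_ofReal_mul] at hpos
    linarith
  · have hherm := cscl_bond_herm ρ hρ β (2 * S + 1) X X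
    -- `Q = conj Q` forces `Im Q = 0`
    have := congrArg Complex.im hherm
    rw [Complex.conj_im] at this
    linarith

/-- **Cauchy–Schwarz for the site form** on positive-time cylinder observables (`maxTime + 2 ≤ S`, `β ≥ 0`):
`‖Q₁(X,Y)‖² ≤ Re Q₁(X,X) · Re Q₁(Y,Y)`, and `Q₁(X,X)` is real `≥ 0`. [folklore] -/
theorem cscl_site_cs (hρ : Continuous ρ) {β : ℝ} (hβ : 0 ≤ β) {S : ℕ} {X Y : LGConfig 4 G → ℂ}
    (hXm : Measurable X) (hYm : Measurable Y) (hXb : ∃ C : ℝ, ∀ U, ‖X U‖ ≤ C) (hYb : ∃ C : ℝ, ∀ U, ‖Y U‖ ≤ C)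
    {ΛX ΛY : Finset (Literature.MathematicalPhysics.QuantumLattice.ZdEdge 4)} (hX : IsCylinder X ΛX) (hY : IsCylinder Y ΛY)
    (hΛX : (↑ΛX : Set (Literature.MathematicalPhysics.QuantumLattice.ZdEdge 4)) ⊆ posTimeEdges) (hΛY : (↑ΛY : Set (Literature.MathematicalPhysics.QuantumLattice.ZdEdge 4)) ⊆ posTimeEdges)
    (hSX : maxTime ΛX + 2 ≤ S) (hSY : maxTime ΛY + 2 ≤ S) :
    ‖∫ U, conj (X (gaugeTimeReflect (torusLift (2 * S + 1) U))) * Y (gaugeTimeShift (torusLift (2 * S + 1) U))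
        ∂(wilsonMeasure (d := 4) (L := 2 * S + 1) ρ β)‖ ^ 2 ≤
      (∫ U, conj (X (gaugeTimeReflect (torusLift (2 * S + 1) U))) * X (gaugeTimeShift (torusLift (2 * S + 1) U))
        ∂(wilsonMeasure (d := 4) (L := 2 * S + 1) ρ β)).re *
      (∫ U, conj (Y (gaugeTimeReflect (torusLift (2 * S + 1) U))) * Y (gaugeTimeShift (torusLift (2 * S + 1) U))
        ∂(wilsonMeasure (d := 4) (L := 2 * S + 1) ρ β)).re ∧
    0 ≤ (∫ U, conj (X (gaugeTimeReflect (torusLift (2 * S + 1) U))) * X (gaugeTimeShift (torusLift (2 * S + 1) U))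
        ∂(wilsonMeasure (d := 4) (L := 2 * S + 1) ρ β)).re ∧
    (∫ U, conj (X (gaugeTimeReflect (torusLift (2 * S + 1) U))) * X (gaugeTimeShift (torusLift (2 * S + 1) U))
        ∂(wilsonMeasure (d := 4) (L := 2 * S + 1) ρ β)).im = 0 := by
  refine ⟨?_, torus_rp_site ρ hρ hβ hXm hXb hX hΛX hSX, ?_⟩
  · refine cscl_cs_of_psd _ _ _ fun c => ?_
    obtain ⟨CX, hCX⟩ := hXb
    obtain ⟨CY, hCY⟩ := hYb
    have hFm : Measurable fun V => X V + c * Y V := hXm.add (hYm.const_mul c)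
    have hFb : ∃ C : ℝ, ∀ U, ‖X U + c * Y U‖ ≤ C := ⟨CX + ‖c‖ * CY, fun U =>
      (norm_add_le _ _).trans (add_le_add (hCX U) (by rw [norm_mul]; exact mul_le_mul_of_nonneg_left (hCY U) (norm_nonneg _)))⟩
    have hpos := torus_rp_site (S := S) ρ hρ hβ hFm hFb (cscl_isCylinder_add_smul hX hY c)
      (by rw [Finset.coe_union]; exact Set.union_subset hΛX hΛY)
      (by rw [cscl_maxTime_union]; omega)
    have hexp := cscl_form_expand ρ hρ β hXm hYm ⟨CX, hCX⟩ ⟨CY, hCY⟩ c (L := 2 * S + 1) 1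
    have hτ : ∀ W : LGConfig 4 G, configShift (-(Pi.single 0 (1 : ℤ))) W = gaugeTimeShift W := fun W => rfl
    simp only [hτ] at hexp
    rw [hexp, cscl_site_herm ρ hρ β (2 * S + 1) X Y, ← map_mul, Complex.conj_mul' c, ← Complex.ofReal_pow] at hpos
    simp only [Complex.add_re, Complex.conj_re, Complex.re_ofReal_mul] at hpos
    linarith
  · have hherm := cscl_site_herm ρ hρ β (2 * S + 1) X X
    have := congrArg Complex.im hherm
    rw [Complex.conj_im] at this
    linarith


/-! ### Shifted supports and time ranges -/

omit [Group G] [TopologicalSpace G] [IsTopologicalGroup G] [CompactSpace G] [BorelSpace G] in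
/-- **A time translate of a cylinder observable is a cylinder observable on the translated edges**, and a time
range `[lo, hi]` of the support becomes `[lo + c, hi + c]`. [folklore] -/
theorem cscl_isCylinder_shift {X : LGConfig 4 G → ℂ} {Λ : Finset (Literature.MathematicalPhysics.QuantumLattice.ZdEdge 4)}
    (hX : IsCylinder X Λ) (c : ℤ) {lo hi : ℤ} (hΛ : ∀ e ∈ Λ, lo ≤ e.1 0 ∧ e.1 0 ≤ hi) :
    ∃ Λ' : Finset (Literature.MathematicalPhysics.QuantumLattice.ZdEdge 4),
      IsCylinder (fun V => X (configShift (-(Pi.single 0 c)) V)) Λ' ∧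
        ∀ e ∈ Λ', lo + c ≤ e.1 0 ∧ e.1 0 ≤ hi + c := by
  refine ⟨Λ.image fun e => (e.1 + Pi.single 0 c, e.2), ?_, ?_⟩
  · intro U V hUV
    refine hX fun e he => ?_
    simp only [Literature.MathematicalPhysics.QuantumLattice.configShift_apply]
    have h1 : e.1 - -(Pi.single 0 c : Literature.Probability.LatticeModels.Site 4) = e.1 + Pi.single 0 c := by
      funext j; simp
    rw [h1]
    exact hUV _ (Finset.mem_coe.2 (Finset.mem_image_of_mem _ (Finset.mem_coe.1 he)))
  · intro e he
    obtain ⟨e', he', rfl⟩ := Finset.mem_image.1 he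
    have h := hΛ e' he'
    simp only [Pi.add_apply, Pi.single_eq_same]
    omega

omit [TopologicalSpace G] [IsTopologicalGroup G] [CompactSpace G] [BorelSpace G] in
/-- A support with times in `[lo, hi]`, `0 ≤ lo`, is a positive-time edge set of `maxTime ≤ hi`. [folklore] -/
theorem cscl_timeSupp_finset {Λ : Finset (Literature.MathematicalPhysics.QuantumLattice.ZdEdge 4)} {lo hi : ℤ}
    (hΛ : ∀ e ∈ Λ, lo ≤ e.1 0 ∧ e.1 0 ≤ hi) (hlo : 0 ≤ lo) :
    (↑Λ : Set (Literature.MathematicalPhysics.QuantumLattice.ZdEdge 4)) ⊆ posTimeEdges ∧ (maxTime Λ : ℤ) ≤ max hi 0 := by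
  refine ⟨fun e he => ?_, ?_⟩
  · have h := hΛ e (Finset.mem_coe.1 he)
    show 0 ≤ e.1 0
    omega
  · unfold maxTime
    have : Λ.sup (fun e => (e.1 0).toNat) ≤ (max hi 0).toNat := Finset.sup_le fun e he => by
      have h := hΛ e he
      omega
    have h2 : ((max hi 0).toNat : ℤ) = max hi 0 := Int.toNat_of_nonneg (le_max_right _ _)
    omega

/-! ### The reflected time correlation of one observable: reality, positivity, log-convexity -/

/-- **Reality and positivity**: for `A` supported at times in `[0, w]` and `m + 2w + 6 ≤ 2S`, the pairing
`P_m(A,A) = ∫ conj A(ΘŨ) A(τᵐŨ)` is real and non-negative (`P_{2a} = Q₀(Aτᵃ,Aτᵃ)`, `P_{2a+1} = Q₁(Aτᵃ,Aτᵃ)`).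
[folklore] -/
theorem cscl_seq_nonneg (hρ : Continuous ρ) {β : ℝ} (hβ : 0 ≤ β) {S w : ℕ} {A : LGConfig 4 G → ℂ}
    (hAm : Measurable A) (hAb : ∃ C : ℝ, ∀ U, ‖A U‖ ≤ C) {Λ : Finset (Literature.MathematicalPhysics.QuantumLattice.ZdEdge 4)}
    (hA : IsCylinder A Λ) (hΛ : ∀ e ∈ Λ, 0 ≤ e.1 0 ∧ e.1 0 ≤ (w : ℤ)) (m : ℕ) (hm : m + 2 * w + 6 ≤ 2 * S) :
    0 ≤ (∫ U, conj (A (gaugeTimeReflect (torusLift (2 * S + 1) U))) *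
        A (configShift (-(Pi.single 0 (m : ℤ))) (torusLift (2 * S + 1) U)) ∂(wilsonMeasure (d := 4) (L := 2 * S + 1) ρ β)).re ∧
    (∫ U, conj (A (gaugeTimeReflect (torusLift (2 * S + 1) U))) *
        A (configShift (-(Pi.single 0 (m : ℤ))) (torusLift (2 * S + 1) U)) ∂(wilsonMeasure (d := 4) (L := 2 * S + 1) ρ β)).im = 0 := by
  have hS1 : 1 ≤ S := by omega
  obtain ⟨C, hC⟩ := hAb
  -- `m = 2a` or `m = 2a + 1`
  obtain ⟨a, ha⟩ := Nat.even_or_odd' m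
  -- the shifted observable `A ∘ τᵃ`
  obtain ⟨Λa, hAa, hΛa⟩ := cscl_isCylinder_shift hA (a : ℤ) hΛ
  have hAam : Measurable fun V => A (configShift (-(Pi.single 0 (a : ℤ))) V) := hAm.comp (configShift _).measurable
  have hAab : ∃ C : ℝ, ∀ U, ‖A (configShift (-(Pi.single 0 (a : ℤ))) U)‖ ≤ C := ⟨C, fun U => hC _⟩
  obtain ⟨hpos, hmax⟩ := cscl_timeSupp_finset hΛa (by omega)
  rcases ha with rfl | rfl
  · -- even: bond form of `A ∘ τᵃ`
    have hSX : maxTime Λa + 1 ≤ S := by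
      have : (maxTime Λa : ℤ) ≤ max ((w : ℤ) + a) 0 := hmax
      omega
    obtain ⟨-, h0, him⟩ := cscl_bond_cs ρ hρ hβ hS1 hAam hAam hAab hAab hAa hAa hpos hpos hSX hSX
    have hshift := cscl_shift_pair ρ β (2 * S + 1) A A (a : ℤ) (a : ℤ)
    have hcast : ((a : ℤ) + a) = ((2 * a : ℕ) : ℤ) := by push_cast; ring
    rw [hcast] at hshift
    rw [← hshift]
    exact ⟨h0, him⟩
  · -- odd: site form of `A ∘ τᵃ`
    have hSX : maxTime Λa + 2 ≤ S := by
      have : (maxTime Λa : ℤ) ≤ max ((w : ℤ) + a) 0 := hmax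
      omega
    obtain ⟨-, h0, him⟩ := cscl_site_cs ρ hρ hβ hAam hAam hAab hAab hAa hAa hpos hpos hSX hSX
    have hshift := cscl_shift_pair ρ β (2 * S + 1) A A (a : ℤ) ((a : ℤ) + 1)
    have hcast : ((a : ℤ) + (a + 1)) = ((2 * a + 1 : ℕ) : ℤ) := by push_cast; ring
    rw [hcast] at hshift
    have hτ : ∀ W : LGConfig 4 G, configShift (-(Pi.single 0 ((a : ℤ) + 1))) W =
        configShift (-(Pi.single 0 (a : ℤ))) (gaugeTimeShift W) := fun W =>
      (rpShift_configShift_gaugeTimeShift (a : ℤ) W).symm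
    simp only [hτ] at hshift
    rw [← hshift]
    exact ⟨h0, him⟩

/-- **Log-convexity**: for `A` supported at times in `[0, w]`, `1 ≤ m` and `m + 2w + 7 ≤ 2S`,
`(Re P_m)² ≤ Re P_{m−1} · Re P_{m+1}` (`P_{2a+1} = Q₀(Aτᵃ, Aτᵃ⁺¹)`, `P_{2a} = Q₁(Aτᵃ⁻¹, Aτᵃ)`, Cauchy–Schwarz).
[folklore] -/
theorem cscl_seq_logConvex (hρ : Continuous ρ) {β : ℝ} (hβ : 0 ≤ β) {S w : ℕ} {A : LGConfig 4 G → ℂ}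
    (hAm : Measurable A) (hAb : ∃ C : ℝ, ∀ U, ‖A U‖ ≤ C) {Λ : Finset (Literature.MathematicalPhysics.QuantumLattice.ZdEdge 4)}
    (hA : IsCylinder A Λ) (hΛ : ∀ e ∈ Λ, 0 ≤ e.1 0 ∧ e.1 0 ≤ (w : ℤ)) (m : ℕ) (hm1 : 1 ≤ m)
    (hm : m + 2 * w + 7 ≤ 2 * S) :
    (∫ U, conj (A (gaugeTimeReflect (torusLift (2 * S + 1) U))) *
        A (configShift (-(Pi.single 0 (m : ℤ))) (torusLift (2 * S + 1) U)) ∂(wilsonMeasure (d := 4) (L := 2 * S + 1) ρ β)).re ^ 2 ≤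
      (∫ U, conj (A (gaugeTimeReflect (torusLift (2 * S + 1) U))) *
        A (configShift (-(Pi.single 0 ((m - 1 : ℕ) : ℤ))) (torusLift (2 * S + 1) U)) ∂(wilsonMeasure (d := 4) (L := 2 * S + 1) ρ β)).re *
      (∫ U, conj (A (gaugeTimeReflect (torusLift (2 * S + 1) U))) *
        A (configShift (-(Pi.single 0 ((m + 1 : ℕ) : ℤ))) (torusLift (2 * S + 1) U)) ∂(wilsonMeasure (d := 4) (L := 2 * S + 1) ρ β)).re := by
  have hS1 : 1 ≤ S := by omega
  obtain ⟨C, hC⟩ := hAb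
  have hshm : ∀ b : ℤ, Measurable fun V => A (configShift (-(Pi.single 0 b)) V) := fun b =>
    hAm.comp (configShift _).measurable
  have hshb : ∀ b : ℤ, ∃ C : ℝ, ∀ U, ‖A (configShift (-(Pi.single 0 b)) U)‖ ≤ C := fun b => ⟨C, fun U => hC _⟩
  -- reality of `P_m` (to convert `‖P_m‖² = (Re P_m)²`)
  have hreal := (cscl_seq_nonneg (S := S) ρ hρ hβ hAm ⟨C, hC⟩ hA hΛ m (by omega)).2
  have hnorm : ∀ z : ℂ, z.im = 0 → ‖z‖ ^ 2 = z.re ^ 2 := fun z hz => by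
    rw [Complex.sq_norm, Complex.normSq_apply, hz]; ring
  obtain ⟨a, ha⟩ := Nat.even_or_odd' m
  rcases ha with rfl | rfl
  · -- `m = 2a`, `a ≥ 1`: site form of `(Aτ^{a-1}, Aτᵃ)`
    have ha1 : 1 ≤ a := by omega
    obtain ⟨Λ1, hA1, hΛ1⟩ := cscl_isCylinder_shift hA ((a : ℤ) - 1) hΛ
    obtain ⟨Λ2, hA2, hΛ2⟩ := cscl_isCylinder_shift hA (a : ℤ) hΛ
    obtain ⟨hpos1, hmax1⟩ := cscl_timeSupp_finset hΛ1 (by omega)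
    obtain ⟨hpos2, hmax2⟩ := cscl_timeSupp_finset hΛ2 (by omega)
    have hS1' : maxTime Λ1 + 2 ≤ S := by
      have : (maxTime Λ1 : ℤ) ≤ max ((w : ℤ) + (a - 1)) 0 := hmax1
      omega
    have hS2' : maxTime Λ2 + 2 ≤ S := by
      have : (maxTime Λ2 : ℤ) ≤ max ((w : ℤ) + a) 0 := hmax2
      omega
    obtain ⟨hcs, -, -⟩ := cscl_site_cs ρ hρ hβ (hshm _) (hshm _) (hshb _) (hshb _) hA1 hA2 hpos1 hpos2 hS1' hS2'
    -- identify the three pairings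
    have e12 := cscl_shift_pair ρ β (2 * S + 1) A A ((a : ℤ) - 1) ((a : ℤ) + 1)
    have e11 := cscl_shift_pair ρ β (2 * S + 1) A A ((a : ℤ) - 1) ((a : ℤ) - 1 + 1)
    have e22 := cscl_shift_pair ρ β (2 * S + 1) A A (a : ℤ) ((a : ℤ) + 1)
    have hτ : ∀ (b : ℤ) (W : LGConfig 4 G), configShift (-(Pi.single 0 (b + 1))) W =
        configShift (-(Pi.single 0 b)) (gaugeTimeShift W) := fun b W =>
      (rpShift_configShift_gaugeTimeShift b W).symm
    simp only [hτ] at e12 e11 e22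
    have c12 : ((a : ℤ) - 1 + (a + 1)) = ((2 * a : ℕ) : ℤ) := by push_cast; ring
    have c11 : ((a : ℤ) - 1 + (a - 1 + 1)) = ((2 * a - 1 : ℕ) : ℤ) := by
      rw [Nat.cast_sub (by omega)]; push_cast; ring
    have c22 : ((a : ℤ) + (a + 1)) = ((2 * a + 1 : ℕ) : ℤ) := by push_cast; ring
    rw [c12] at e12; rw [c11] at e11; rw [c22] at e22
    rw [e12, e11, e22] at hcs
    rwa [hnorm _ hreal] at hcs
  · -- `m = 2a+1`: bond form of `(Aτᵃ, Aτᵃ⁺¹)`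
    obtain ⟨Λ1, hA1, hΛ1⟩ := cscl_isCylinder_shift hA (a : ℤ) hΛ
    obtain ⟨Λ2, hA2, hΛ2⟩ := cscl_isCylinder_shift hA ((a : ℤ) + 1) hΛ
    obtain ⟨hpos1, hmax1⟩ := cscl_timeSupp_finset hΛ1 (by omega)
    obtain ⟨hpos2, hmax2⟩ := cscl_timeSupp_finset hΛ2 (by omega)
    have hS1' : maxTime Λ1 + 1 ≤ S := by
      have : (maxTime Λ1 : ℤ) ≤ max ((w : ℤ) + a) 0 := hmax1
      omega
    have hS2' : maxTime Λ2 + 1 ≤ S := by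
      have : (maxTime Λ2 : ℤ) ≤ max ((w : ℤ) + (a + 1)) 0 := hmax2
      omega
    obtain ⟨hcs, -, -⟩ := cscl_bond_cs ρ hρ hβ hS1 (hshm _) (hshm _) (hshb _) (hshb _) hA1 hA2 hpos1 hpos2 hS1' hS2'
    have e12 := cscl_shift_pair ρ β (2 * S + 1) A A (a : ℤ) ((a : ℤ) + 1)
    have e11 := cscl_shift_pair ρ β (2 * S + 1) A A (a : ℤ) (a : ℤ)
    have e22 := cscl_shift_pair ρ β (2 * S + 1) A A ((a : ℤ) + 1) ((a : ℤ) + 1)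
    have c12 : ((a : ℤ) + (a + 1)) = ((2 * a + 1 : ℕ) : ℤ) := by push_cast; ring
    have c11 : ((a : ℤ) + a) = ((2 * a + 1 - 1 : ℕ) : ℤ) := by
      rw [Nat.add_sub_cancel]; push_cast; ring
    have c22 : ((a : ℤ) + 1 + (a + 1)) = ((2 * a + 1 + 1 : ℕ) : ℤ) := by push_cast; ring
    rw [c12] at e12; rw [c11] at e11; rw [c22] at e22
    rw [e12, e11, e22] at hcs
    rwa [hnorm _ hreal] at hcs

end Torus

/-- **Registered anchor of this file** (closed form of `cscl_timeSupp_finset`'s first half, for the gate's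
`--supports` stub check). [folklore] -/
theorem cscl_anchor_chord :
    ∀ (Λ : Finset (Literature.MathematicalPhysics.QuantumLattice.ZdEdge 4)) (lo hi : ℤ),
      (∀ e ∈ Λ, lo ≤ e.1 0 ∧ e.1 0 ≤ hi) → 0 ≤ lo →
        (↑Λ : Set (Literature.MathematicalPhysics.QuantumLattice.ZdEdge 4)) ⊆ posTimeEdges :=
  fun _ _ _ hΛ hlo => (cscl_timeSupp_finset hΛ hlo).1

end Summit.QuantumFields.YangMills.Theorems.ContinuumLegGivenGap

end
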